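/-
COR-CM (cells pub-hodgecm / pub-hodgecm2, stage 2 of the Hodge ladder) — TRANSPOSITION item (vi), S-LANE CARRIERS-PLAN step S7, RE-CUT #4 («PLUGGED-R»): the
landed RE-CUT #3 «PLUGGED» `Transposition/Item6SupplyPinnedAssemblyAlongHoldsRestOnePlugged.lean` (own-htheta, p323209) with its LAST CM-side posited datum NO
LONGER POSITED: the de Rham token `R : ∀ F ι₁ V Φ A i, Type` of [Liu2021] Def. 4.5 (2) bullet 4 (`r_μ`, FJcycle.tex l. 1957) is INSTANTIATED by the real
carrier `Def45.RMuForm ι₁ _` (pin-2, `Liu2021/Def45RMuForm.lean`: bullet 4 typed REAL as `Def45.IsRMuNormalisable` — the printed normalisation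
`c(⟨r_μ(x), r_μ(y)⟩_λ) = Tr_{M_μ ⊗ E/E}(x β ȳ)` asked on EVERY admissible `E ⊗ M_μ`-orbit of `H¹(A_ℂ(ℂ); ℂ)`, READING P-R2) and its inhabitation
`hR` is DISCHARGED by `Def45.rMuForm_nonempty` (pin-2, `Liu2021/Def45RMuFormSupply.lean`, over hcmisog-isog-2's engine `Liu2021/Def45RMuExists` /
`Def45RMuExistsNonVacuity`: at every face of a GALOIS CM field every abstract de Rham datum admits the printed `r_μ` — trace duality [Deligne1982, Lemma 4.3]
+ «every Hermitian unit of `E ⊗ M_μ` is a norm», `Def45RMuGalois`; general-algebra layer of record b25's `CorCM/RMuNorm*`).  EFFECT ON THE DISPLAY of p323209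
§2 (9 named + hM): `R`, `hR` GONE; nothing added.  Displayed hypotheses of §2: data {C, T} · cites {h, hA, h21} · readings {hLiu, hirr} = 7 NAMED + hM; on the
CM side ONLY the cite `h21` ([Shimura1998] Thm. 21.4 = Casselman's theorem) remains.  Both theorems are ONE APPLICATION of p323209's, no `rw`, no `▸`,
no auxiliary `def`, default heartbeats.  HONEST SCOPE: a DISPLAY re-cut, count-neutral; NOT «S2 SUPPLY CLOSED»; `FaceSupply U_rec` OPEN; socket
UNINHABITED; hM NOT signed equal; **HC_CM is NOT proved**; wording of record «HC_CM follows in the kernel from BallQuotientUniformised ∧ PerLFace(model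
universe of record)» untouched.  Class sentences (W1)/(W3) of p323209's header stand VERBATIM except that (W1)'s residual «+ l. 1982 (r_μ obvious)» is now a
THEOREM for the `H¹`-reading (class of READING P-R2: bullet 4 read on `H¹ = (H_1)^∨`; ≥ print as a restriction since asked on every admissible orbit, the
de Rham `E`-structure being one by [Grothendieck1966, Thm. 1′] + [Deligne1982, §1]; = print at Galois faces since proved).
-/
import Summits.HodgeConjecture.CorCM.B01.Transposition.Item6SupplyPinnedAssemblyAlongHoldsRestOnePlugged
import Literature.NumberTheory.Automorphic.Liu2021.Def45RMuFormSupply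
import HarnessLib

set_option autoImplicit false

/-!
# B01-S and the (β)-free END display at the PLUGGED-R rest: re-cut #3 «PLUGGED» with the de Rham token `R`/`hR` instantiated and discharged (S7, re-cut #4)

Instantiation of own-htheta's `…_restOne_plugged` (§1 :94) / `…_restOne_plugged_meeting_rec` (§2 :146), both BY ONE APPLICATION:
`R := fun F _ ι₁ V Φ => Def45.RMuForm ι₁ (isConjugateSymplectic_muOfInvType ι₁ Φ)`;
`hR := fun F _ ι₁ V Φ A i => Def45.rMuForm_nonempty ι₁ (isConjugateSymplectic_muOfInvType ι₁ Φ) A i`.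
All displayed types agree after β-reduction.  Later plugs by application on THIS theorem, unchanged from p323209's header: `C := Model.sec42DataOf …` (S5),
`T := heckeTranslatesFamilyOf …` (S6, TEAM hComp), `hirr ↦ (hD1 : LemD1AsPrinted …)`, `hA ↦ …_of_albanese_baseChange hAbc`.  HC_CM is NOT proved.

References: Y. Liu, arXiv:2102.11518 = Camb. J. Math. 9 (2021) (`FJcycle.tex` md5 6db49a74122d): Def. 4.5 (2) l. 1944–1958 (bullet 4 l. 1957), Prop. 4.6 (1)
l. 1969 + proof l. 1975–1984 («the existence of r_μ is obvious» l. 1982), Thm. 4.18 l. 2232–2245, §4.2 l. 2053–2074.  G. Shimura, *Abelian Varieties with Complex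
Multiplication and Modular Functions* (1998), Thm. 21.4, §6.2 Thm. 4.  A. Grothendieck, Publ. Math. IHÉS 29 (1966) Thm. 1′.  P. Deligne, LNM 900 (1982) §1, §4 Lemma 4.3.
-/

noncomputable section

open scoped TensorProduct InnerProductSpace Kronecker

namespace Summit.HodgeConjecture.CorCM.Model

open CategoryTheory CategoryTheory.Limits AlgebraicGeometry NumberField
open Literature.AlgebraicGeometry.Motives
open Literature.AlgebraicGeometry.HodgeTheory
open Literature.AlgebraicGeometry.ShimuraVarieties
open Literature.AlgebraicGeometry.ShimuraVarieties.UnitaryCanonicalModel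
open Literature.NumberTheory.ComplexMultiplication
open Literature.NumberTheory.Automorphic
open Literature.NumberTheory.Automorphic.IdeleClassGroup
open Literature.NumberTheory.Automorphic.PicardCM
open Literature.NumberTheory.Automorphic.Liu2021
open Literature.NumberTheory.Automorphic.Liu2021.AppendixC
open Literature.NumberTheory.Automorphic.Liu2021.AppendixC.RestOne
open Literature.NumberTheory.Automorphic.Liu2021.Def411WeilCarriers (JW TW isSymm_TW isUnit_det_TW JW_eq)
open Literature.NumberTheory.GelbartRogawski1991 Literature.NumberTheory.GelbartRogawski1991.UnitaryDualPair
open Literature.NumberTheory.Weil1964 Literature.RepresentationTheory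
open Summit.HodgeConjecture.CorCM.Transposition

/-! ## §1  B01-S at the PLUGGED-R rest (by application of re-cut #3 «PLUGGED») -/

/-- **B01-S from [Liu2021, Thm. 4.18] at the PLUGGED-R one-object rest** (`U = picardCMUniverse hHD hI h₁ h₃`): own-htheta's
`faceSupply_of_thm418AsPrinted_along_conj_holds_restOne_plugged` (p323209 §1) at `R := Def45.RMuForm ι₁ _` (Def. 4.5 (2) bullet 4 `r_μ` typed REAL) and
`hR := Def45.rMuForm_nonempty ι₁ _` (its supply at every Galois face) — ONE APPLICATION.  Displayed: the cites `h` ([Deligne1979] 2.1.2/2.2.5), `hA`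
([Liu2021] §2.1 + [FGA]), `h21` ([Shimura1998] Thm. 21.4); the POSITED carriers `C` (§4.2 / App. C system over the honest P5 datum and the DEFINED `isoOf`),
`T` (Hecke translates); the cite `hLiu` (Thm. 4.18 l. 2232–2245 for the χ_μ-oscillator at the constructed Hecke action — class (W3) «= as printed under (α)»
of p323209's header) and the reading `hirr` (Def. 4.11 «irreducible», [Liu2021] Lem. D.1 (1)).  NO `R`, `hR` binder (and, as in p323209, no `iso`, `P`, `s`,
`hs`, `hsc`, `hObj`, `hChi`, `hsm`, `rhoΩ`, `hμ`, `i`, `hdim`, `hdet45`).  HC_CM is NOT proved; none of the hypotheses is inhabited here.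
[cite: Liu2021, Thm. 4.18 (FJcycle.tex l. 2232–2245), Prop. 4.6 (1) (l. 1969, proof l. 1975–1984), Def. 4.5 (2) (l. 1944–1958)]
[cite: Shimura1998, §21.4 Thm. 21.4 and §6.2 Theorem 4] [cite: Deligne1979ShimuraVarieties, §2.1.2 and 2.2.5] -/
theorem faceSupply_of_thm418AsPrinted_along_conj_holds_restOne_pluggedR
    (hHD : exists_isReal_hodgeModel) (hI : hodgePQ_independent_of_hodgeModel)
    (h₁ : BallQuotientUniformised) (h₃ : CMAbelianVarietyRealised)
    (h : exists_recordSystem) (hA : albanese_baseChange_isLimit_fan_jacobian)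
    (C : ∀ (F : CMField) (ι₁ : F →+* ℂ) (V : HermSpace3 F ι₁) (Φ : CMType F), Sec42Data (honestP5Of h F ι₁ V Φ) (isoOf F ι₁ V Φ))
    (T : ∀ (F : CMField) (ι₁ : F →+* ℂ) (V : HermSpace3 F ι₁) (Φ : CMType F), 6 ≤ Module.finrank ℚ F →
      (C F ι₁ V Φ).HeckeTranslates)
    (hLiu : ∀ (F : CMField) [IsGalois ℚ F] (h6 : 6 ≤ Module.finrank ℚ F) (Φ : CMType F) (ι₁ : F →+* ℂ), ι₁ ∈ Φ.1 →
      ∀ V : HermSpace3 F ι₁, Thm418AsPrintedC (C F ι₁ V Φ)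
        (restOne (C F ι₁ V Φ) (AlgHom.id ℚ F) ι₁ (isConjugateSymplectic_muOfInvType ι₁ Φ) (hasWeight_one_muOfInvType ι₁ Φ) (Def45.Carriers.ofPolDR (muOfInvType ι₁ Φ) (Def45.PolDR ι₁ (isConjugateSymplectic_muOfInvType ι₁ Φ) (Def45.RMuForm ι₁ (isConjugateSymplectic_muOfInvType ι₁ Φ))))
            (Def411WeilCarriers.Eps ↥(maximalRealSubfield F) (imagUnitSq F)) (Def411WeilCarriers.epsOf ↥(maximalRealSubfield F) (imagUnitSq F) F (imagUnit F)) (Def411WeilCarriers.Chi ↥(maximalRealSubfield F) F (IsCMField.complexConj F))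
            (Def411WeilCarriers.omega ↥(maximalRealSubfield F) F (IsCMField.complexConj F) 3 finProdFinEquiv (Matrix.diagonal V.diagEntries) (complexConj_imagUnit F) (imagUnit_ne_zero F) (imagUnit_mul_self F) (realDiagonal_isSymm F V.diagEntries V.complexConj_diagEntries) (isUnit_det_realDiagonal F V.diagEntries V.complexConj_diagEntries V.diagEntries_ne_zero) (realDiagonal_map F V.diagEntries V.complexConj_diagEntries).symm (OmegaMuSplitting.hsMu F ι₁ V Φ))
            (Def411WeilCarriers.rho ↥(maximalRealSubfield F) F (IsCMField.complexConj F) 3 finProdFinEquiv (Matrix.diagonal V.diagEntries) (complexConj_imagUnit F) (imagUnit_ne_zero F) (imagUnit_mul_self F) (realDiagonal_isSymm F V.diagEntries V.complexConj_diagEntries) (isUnit_det_realDiagonal F V.diagEntries V.complexConj_diagEntries V.diagEntries_ne_zero) (realDiagonal_map F V.diagEntries V.complexConj_diagEntries).symm (OmegaMuSplitting.hsMu F ι₁ V Φ) V.adelicFinDiag.toMulEquiv.toMonoidHom) ((T F ι₁ V Φ h6).rhoΩOne (AlgHom.id ℚ F) ι₁ (isConjugateSymplectic_muOfInvType ι₁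 Φ) (hasWeight_one_muOfInvType ι₁ Φ) (Def45.Carriers.ofPolDR (muOfInvType ι₁ Φ) (Def45.PolDR ι₁ (isConjugateSymplectic_muOfInvType ι₁ Φ) (Def45.RMuForm ι₁ (isConjugateSymplectic_muOfInvType ι₁ Φ)))))))
    (h21 : shimura1998_thm21_4_casselman)
    (hirr : ∀ (F : CMField) [IsGalois ℚ F] (h6 : 6 ≤ Module.finrank ℚ F) (Φ : CMType F) (ι₁ : F →+* ℂ), ι₁ ∈ Φ.1 →
      ∀ (V : HermSpace3 F ι₁)
        (i : (toThm418Data (C F ι₁ V Φ)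
          (restOne (C F ι₁ V Φ) (AlgHom.id ℚ F) ι₁ (isConjugateSymplectic_muOfInvType ι₁ Φ) (hasWeight_one_muOfInvType ι₁ Φ) (Def45.Carriers.ofPolDR (muOfInvType ι₁ Φ) (Def45.PolDR ι₁ (isConjugateSymplectic_muOfInvType ι₁ Φ) (Def45.RMuForm ι₁ (isConjugateSymplectic_muOfInvType ι₁ Φ))))
            (Def411WeilCarriers.Eps ↥(maximalRealSubfield F) (imagUnitSq F)) (Def411WeilCarriers.epsOf ↥(maximalRealSubfield F) (imagUnitSq F) F (imagUnit F)) (Def411WeilCarriers.Chi ↥(maximalRealSubfield F) F (IsCMField.complexConj F))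
            (Def411WeilCarriers.omega ↥(maximalRealSubfield F) F (IsCMField.complexConj F) 3 finProdFinEquiv (Matrix.diagonal V.diagEntries) (complexConj_imagUnit F) (imagUnit_ne_zero F) (imagUnit_mul_self F) (realDiagonal_isSymm F V.diagEntries V.complexConj_diagEntries) (isUnit_det_realDiagonal F V.diagEntries V.complexConj_diagEntries V.diagEntries_ne_zero) (realDiagonal_map F V.diagEntries V.complexConj_diagEntries).symm (OmegaMuSplitting.hsMu F ι₁ V Φ))
            (Def411WeilCarriers.rho ↥(maximalRealSubfield F) F (IsCMField.complexConj F) 3 finProdFinEquiv (Matrix.diagonal V.diagEntries) (complexConj_imagUnit F) (imagUnit_ne_zero F) (imagUnit_mul_self F) (realDiagonal_isSymm F V.diagEntries V.complexConj_diagEntries) (isUnit_det_realDiagonal F V.diagEntries V.complexConj_diagEntries V.diagEntries_ne_zero) (realDiagonal_map F V.diagEntries V.complexConj_diagEntries).symm (OmegaMuSplitting.hsMu F ι₁ V Φ) V.adelicFinDiag.toMulEquiv.toMonoidHom) ((T F ι₁ V Φ h6).rhoΩOne (AlgHom.id ℚ F) ι₁ (isConjugateSymplectic_muOfInvType ι₁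 Φ) (hasWeight_one_muOfInvType ι₁ Φ) (Def45.Carriers.ofPolDR (muOfInvType ι₁ Φ) (Def45.PolDR ι₁ (isConjugateSymplectic_muOfInvType ι₁ Φ) (Def45.RMuForm ι₁ (isConjugateSymplectic_muOfInvType ι₁ Φ))))))).AdmIndex),
        (Def411WeilCarriers.rho ↥(maximalRealSubfield F) F (IsCMField.complexConj F) 3 finProdFinEquiv (Matrix.diagonal V.diagEntries) (complexConj_imagUnit F) (imagUnit_ne_zero F) (imagUnit_mul_self F) (realDiagonal_isSymm F V.diagEntries V.complexConj_diagEntries) (isUnit_det_realDiagonal F V.diagEntries V.complexConj_diagEntries V.diagEntries_ne_zero) (realDiagonal_map F V.diagEntries V.complexConj_diagEntries).symm (OmegaMuSplitting.hsMu F ι₁ V Φ) V.adelicFinDiag.toMulEquiv.toMonoidHom i.1.1 i.1.2).IsIrreducible) :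
    (picardCMUniverse hHD hI h₁ h₃).FaceSupply :=
  faceSupply_of_thm418AsPrinted_along_conj_holds_restOne_plugged hHD hI h₁ h₃ h hA C
    -- Def. 4.5 (2) bullet 4 `r_μ`: the token `R` INSTANTIATED by the real carrier `Def45.RMuForm` (pin-2, `Liu2021/Def45RMuForm.lean`)
    (fun _ _ ι₁ _ Φ => Def45.RMuForm ι₁ (isConjugateSymplectic_muOfInvType ι₁ Φ))
    -- … and `hR` DISCHARGED by the supply theorem (pin-2 over hcmisog-isog-2's engine, `Liu2021/Def45RMuFormSupply.lean`)
    (fun _ _ ι₁ _ Φ A i => Def45.rMuForm_nonempty ι₁ (isConjugateSymplectic_muOfInvType ι₁ Φ) A i)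
    T hLiu h21 hirr


/-! ## §2  THE (β)-FREE END DISPLAY, MEETING FORM, on the universe of record, at the PLUGGED-R rest -/

section MeetingFormPluggedR

open MeasureTheory
open Prior.Perl34File (Perl34.IsolationSetting)
open Prior.Perl34File.Perl34

/-- **END DISPLAY, (β)-FREE MEETING FORM, on the universe OF RECORD, at the PLUGGED-R rest** (`let U := U_rec`): own-htheta's
`hc_cm_of_thm418AsPrinted_along_conj_holds_restOne_plugged_meeting_rec` (p323209 §2 :146) at `R := Def45.RMuForm ι₁ _`, `hR := Def45.rMuForm_nonempty ι₁ _` — ONE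
APPLICATION.  Displayed hypotheses = data {`C`, `T`} · cites {`h`, `hA`, `h21`} · readings {`hLiu`, `hirr`} + the theta-side meeting binder `hM` (b01-x2's text
VERBATIM at `U_rec`) = 7 NAMED + hM; on the CM side only the cite `h21`.  HC_CM is NOT proved: no hypothesis is inhabited here.
[cite: Liu2021, Thm. 4.18 (FJcycle.tex l. 2232–2245), Prop. 4.6 (1) (l. 1969), Def. 4.5 (2) (l. 1944–1958)] [cite: Shimura1998, §21.4 Thm. 21.4]
[cite: Deligne1979ShimuraVarieties, §2.1.2 and 2.2.5] -/
theorem hc_cm_of_thm418AsPrinted_along_conj_holds_restOne_pluggedR_meeting_rec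
    (h : exists_recordSystem) (hA : albanese_baseChange_isLimit_fan_jacobian)
    (C : ∀ (F : CMField) (ι₁ : F →+* ℂ) (V : HermSpace3 F ι₁) (Φ : CMType F), Sec42Data (honestP5Of h F ι₁ V Φ) (isoOf F ι₁ V Φ))
    (T : ∀ (F : CMField) (ι₁ : F →+* ℂ) (V : HermSpace3 F ι₁) (Φ : CMType F), 6 ≤ Module.finrank ℚ F →
      (C F ι₁ V Φ).HeckeTranslates)
    (hLiu : ∀ (F : CMField) [IsGalois ℚ F] (h6 : 6 ≤ Module.finrank ℚ F) (Φ : CMType F) (ι₁ : F →+* ℂ), ι₁ ∈ Φ.1 →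
      ∀ V : HermSpace3 F ι₁, Thm418AsPrintedC (C F ι₁ V Φ)
        (restOne (C F ι₁ V Φ) (AlgHom.id ℚ F) ι₁ (isConjugateSymplectic_muOfInvType ι₁ Φ) (hasWeight_one_muOfInvType ι₁ Φ) (Def45.Carriers.ofPolDR (muOfInvType ι₁ Φ) (Def45.PolDR ι₁ (isConjugateSymplectic_muOfInvType ι₁ Φ) (Def45.RMuForm ι₁ (isConjugateSymplectic_muOfInvType ι₁ Φ))))
            (Def411WeilCarriers.Eps ↥(maximalRealSubfield F) (imagUnitSq F)) (Def411WeilCarriers.epsOf ↥(maximalRealSubfield F) (imagUnitSq F) F (imagUnit F)) (Def411WeilCarriers.Chi ↥(maximalRealSubfield F) F (IsCMField.complexConj F))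
            (Def411WeilCarriers.omega ↥(maximalRealSubfield F) F (IsCMField.complexConj F) 3 finProdFinEquiv (Matrix.diagonal V.diagEntries) (complexConj_imagUnit F) (imagUnit_ne_zero F) (imagUnit_mul_self F) (realDiagonal_isSymm F V.diagEntries V.complexConj_diagEntries) (isUnit_det_realDiagonal F V.diagEntries V.complexConj_diagEntries V.diagEntries_ne_zero) (realDiagonal_map F V.diagEntries V.complexConj_diagEntries).symm (OmegaMuSplitting.hsMu F ι₁ V Φ))
            (Def411WeilCarriers.rho ↥(maximalRealSubfield F) F (IsCMField.complexConj F) 3 finProdFinEquiv (Matrix.diagonal V.diagEntries) (complexConj_imagUnit F) (imagUnit_ne_zero F) (imagUnit_mul_self F) (realDiagonal_isSymm F V.diagEntries V.complexConj_diagEntries) (isUnit_det_realDiagonal F V.diagEntries V.complexConj_diagEntries V.diagEntries_ne_zero) (realDiagonal_map F V.diagEntries V.complexConj_diagEntries).symm (OmegaMuSplitting.hsMu F ι₁ V Φ) V.adelicFinDiag.toMulEquiv.toMonoidHom) ((T F ι₁ V Φ h6).rhoΩOne (AlgHom.id ℚ F) ι₁ (isConjugateSymplectic_muOfInvType ι₁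 Φ) (hasWeight_one_muOfInvType ι₁ Φ) (Def45.Carriers.ofPolDR (muOfInvType ι₁ Φ) (Def45.PolDR ι₁ (isConjugateSymplectic_muOfInvType ι₁ Φ) (Def45.RMuForm ι₁ (isConjugateSymplectic_muOfInvType ι₁ Φ)))))))
    (h21 : shimura1998_thm21_4_casselman)
    (hirr : ∀ (F : CMField) [IsGalois ℚ F] (h6 : 6 ≤ Module.finrank ℚ F) (Φ : CMType F) (ι₁ : F →+* ℂ), ι₁ ∈ Φ.1 →
      ∀ (V : HermSpace3 F ι₁)
        (i : (toThm418Data (C F ι₁ V Φ)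
          (restOne (C F ι₁ V Φ) (AlgHom.id ℚ F) ι₁ (isConjugateSymplectic_muOfInvType ι₁ Φ) (hasWeight_one_muOfInvType ι₁ Φ) (Def45.Carriers.ofPolDR (muOfInvType ι₁ Φ) (Def45.PolDR ι₁ (isConjugateSymplectic_muOfInvType ι₁ Φ) (Def45.RMuForm ι₁ (isConjugateSymplectic_muOfInvType ι₁ Φ))))
            (Def411WeilCarriers.Eps ↥(maximalRealSubfield F) (imagUnitSq F)) (Def411WeilCarriers.epsOf ↥(maximalRealSubfield F) (imagUnitSq F) F (imagUnit F)) (Def411WeilCarriers.Chi ↥(maximalRealSubfield F) F (IsCMField.complexConj F))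
            (Def411WeilCarriers.omega ↥(maximalRealSubfield F) F (IsCMField.complexConj F) 3 finProdFinEquiv (Matrix.diagonal V.diagEntries) (complexConj_imagUnit F) (imagUnit_ne_zero F) (imagUnit_mul_self F) (realDiagonal_isSymm F V.diagEntries V.complexConj_diagEntries) (isUnit_det_realDiagonal F V.diagEntries V.complexConj_diagEntries V.diagEntries_ne_zero) (realDiagonal_map F V.diagEntries V.complexConj_diagEntries).symm (OmegaMuSplitting.hsMu F ι₁ V Φ))
            (Def411WeilCarriers.rho ↥(maximalRealSubfield F) F (IsCMField.complexConj F) 3 finProdFinEquiv (Matrix.diagonal V.diagEntries) (complexConj_imagUnit F) (imagUnit_ne_zero F) (imagUnit_mul_self F) (realDiagonal_isSymm F V.diagEntries V.complexConj_diagEntries) (isUnit_det_realDiagonal F V.diagEntries V.complexConj_diagEntries V.diagEntries_ne_zero) (realDiagonal_map F V.diagEntries V.complexConj_diagEntries).symm (OmegaMuSplitting.hsMu F ι₁ V Φ) V.adelicFinDiag.toMulEquiv.toMonoidHom) ((T F ι₁ V Φ h6).rhoΩOne (AlgHom.id ℚ F) ι₁ (isConjugateSymplectic_muOfInvType ι₁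 Φ) (hasWeight_one_muOfInvType ι₁ Φ) (Def45.Carriers.ofPolDR (muOfInvType ι₁ Φ) (Def45.PolDR ι₁ (isConjugateSymplectic_muOfInvType ι₁ Φ) (Def45.RMuForm ι₁ (isConjugateSymplectic_muOfInvType ι₁ Φ))))))).AdmIndex),
        (Def411WeilCarriers.rho ↥(maximalRealSubfield F) F (IsCMField.complexConj F) 3 finProdFinEquiv (Matrix.diagonal V.diagEntries) (complexConj_imagUnit F) (imagUnit_ne_zero F) (imagUnit_mul_self F) (realDiagonal_isSymm F V.diagEntries V.complexConj_diagEntries) (isUnit_det_realDiagonal F V.diagEntries V.complexConj_diagEntries V.diagEntries_ne_zero) (realDiagonal_map F V.diagEntries V.complexConj_diagEntries).symm (OmegaMuSplitting.hsMu F ι₁ V Φ) V.adelicFinDiag.toMulEquiv.toMonoidHom i.1.1 i.1.2).IsIrreducible) :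
    let U := picardCMUniverse exists_isReal_hodgeModel_holds hodgePQ_independent_of_hodgeModel_holds
      BallQuotient.ballQuotientUniformised_holds cmAbelianVarietyRealised_holds
    let hU := ballQuotientUniformisedDatum_of BallQuotient.ballQuotientUniformised_holds
    (∀ (F : CMField), IsGalois ℚ F → 6 ≤ Module.finrank ℚ F → ∀ (f : Face F) (ι₁ : F →+* ℂ), f.Admissible ι₁ →
      ∀ V : HermSpace3 F ι₁,
      ∃ (H CG G SK SigIdx SigIdxG : Type) (_ : NormedAddCommGroup H) (_ : InnerProductSpace ℂ H) (_ : CompleteSpace H)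
        (_ : NormedAddCommGroup CG) (_ : NormedSpace ℂ CG) (_ : Group G) (_ : TopologicalSpace G) (_ : TopologicalSpace SK)
        (S : Perl34.IsolationSetting H (Lp ℂ 2 V.autMeasure) CG G SK SigIdx SigIdxG),
        (∀ (Γ : Level V) (ω₁ ω₂ : U.CohC (U.pms F ι₁ V Γ) 1),
          ω₁ ∈ U.Uiso Γ F (f.psi 0) ι₁ → ω₂ ∈ U.Uiso Γ F (f.psi 1) ι₁ →
            embOf exists_isReal_hodgeModel_holds hodgePQ_independent_of_hodgeModel_holds hU cmAbelianVarietyRealised_holds Γ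
                (U.cup2C (U.pms F ι₁ V Γ) 1 ω₁ ω₂) ≠ 0 →
              ∃ u ∈ S.t12.S12,
                ⟪embOf exists_isReal_hodgeModel_holds hodgePQ_independent_of_hodgeModel_holds hU cmAbelianVarietyRealised_holds Γ
                    (U.cup2C (U.pms F ι₁ V Γ) 1 ω₁ ω₂), u⟫_ℂ ≠ 0) ∧
        (∀ χ : S.t34.X, S.t34.allowed χ → ∀ (Φ : SK) (Γ₁ : Level V)
          (ω₁ ω₂ : U.CohC (U.pms F ι₁ V Γ₁) 1),
          ω₁ ∈ U.Uiso Γ₁ F (f.psi 0) ι₁ →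
          ω₂ ∈ U.Uiso Γ₁ F (f.psi 1) ι₁ →
            ⟪embOf exists_isReal_hodgeModel_holds hodgePQ_independent_of_hodgeModel_holds hU cmAbelianVarietyRealised_holds Γ₁
                (U.cup2C (U.pms F ι₁ V Γ₁) 1 ω₁ ω₂),
              S.t34.ϑ χ Φ⟫_ℂ ≠ 0 →
              ∃ (Γ : Level V) (ω : Fin 4 → U.CohC (U.pms F ι₁ V Γ) 1),
                (∀ i, ω i ∈ U.Uiso Γ F (f.psi i) ι₁) ∧
                  ⟪embOf exists_isReal_hodgeModel_holds hodgePQ_independent_of_hodgeModel_holds hU cmAbelianVarietyRealised_holds Γ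
                      (U.cup2C (U.pms F ι₁ V Γ) 1 (ω 2) (ω 3)),
                    embOf exists_isReal_hodgeModel_holds hodgePQ_independent_of_hodgeModel_holds hU cmAbelianVarietyRealised_holds Γ
                      (U.cup2C (U.pms F ι₁ V Γ) 1 (ω 0) (ω 1))⟫_ℂ
                    ≠ 0)) →
    HC_CM :=
  hc_cm_of_thm418AsPrinted_along_conj_holds_restOne_plugged_meeting_rec h hA C
    (fun _ _ ι₁ _ Φ => Def45.RMuForm ι₁ (isConjugateSymplectic_muOfInvType ι₁ Φ))
    (fun _ _ ι₁ _ Φ A i => Def45.rMuForm_nonempty ι₁ (isConjugateSymplectic_muOfInvType ι₁ Φ) A i)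
    T hLiu h21 hirr

end MeetingFormPluggedR

end Summit.HodgeConjecture.CorCM.Model

end
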